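import Summits.Ventures.HSemireg.WedgeHankelRecurrenceCensusScheme
import Summits.Ventures.HSemireg.WedgeHankelRecurrenceSymbol

/-!
# Venture HSemireg — THE CENSUS BY MINIMAL RECURRENCE FOR EVERY `m` (Euler's function of `K[X]`): **`φ(m) := #unitResidues m` is MULTIPLICATIVE over coprime monic factors —
# `φ(m m′) = φ(m) φ(m′)` by the Chinese remainder bijection `(a, a′) ↦ a m′ + a′ m` on symbols `a/m + a′/m′ = (a m′ + a′ m)/(m m′)` — and `φ(p^k) = s^{dk} − s^{d(k−1)}` for `p` irreducible
# of degree `d`, `k ≥ 1`**; hence `φ(∏ pᵢ^{kᵢ}) = ∏ (s^{dᵢkᵢ} − s^{dᵢ(kᵢ−1)})`, `φ(∏ (X − λᵢ)^{kᵢ}) = ∏ (s − 1) s^{kᵢ−1}` for distinct nodes `λᵢ`, and (N53) as many classes on `[0, N]`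
# with that minimal recurrence (`2 deg m ≤ N + 1`)

HONEST FRAMING. Part of the Lean index of the computation cell `pub-hsemireg` (seat p10 gen 29, Sunday typer «UNIFORM-IN-n»).
LINEAR ALGEBRA OF HANKEL (catalecticant) MATRICES and of polynomials over a field ONLY: no variety, no cohomology theory, no sheaf, no Ext group and no semiregularity map is constructed
here; nothing here says that HC / HC_CM / HC_AV holds; no Literature fact is declared or used.  Custodian versions as in `WedgeHankelSiegelIdeal` (1/3); the dictionary («classes with
apolar scheme `{m = 0}`»; `φ(m) = |(K[X]/(m))ˣ|`, the Euler function of `K[X]`; «nodes `λᵢ` of exact orders `kᵢ − 1`» for `m = ∏ (X − λᵢ)^{kᵢ}`, N20/N35) is QUOTED, never asserted —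
`φ(m)` below is a set count, no quotient ring is formed.

WHAT IS IN THE TREE.  N53 (`WedgeHankelRecurrenceCensusScheme`, № 371): `unitResidues`, `mem_unitResidues_iff`, `ncard_setOf_rank_eq_and_mem_recSpace` (the fibre of the symbol map over `m`
has `φ(m)` classes), `ncard_unitResidues_of_irreducible` (`s^d − 1`); N45 (`WedgeHankelRecurrenceSymbol`, № 327): `isCoprime_mul_add_mul`.  Mathlib: `Set.ncard_prod`, `Set.ncard_congr`,
`Set.ncard_sdiff`, `Set.InjOn.ncard_image`, `Polynomial.modByMonic_add_div`, `Polynomial.degree_modByMonic_lt`, `Polynomial.eq_zero_of_dvd_of_degree_lt`, `IsCoprime.mul_dvd`,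
`IsCoprime.dvd_of_dvd_mul_right`, `IsCoprime.of_mul_left_left/right`, `IsCoprime.pow_left_iff`, `IsCoprime.pow`, `Irreducible.coprime_iff_not_dvd`, `Polynomial.irreducible_X_sub_C`,
`Polynomial.isCoprime_X_sub_C_of_isUnit_sub`, `Polynomial.degreeLTEquiv` (the count `#K[X]_{<d} = s^d`, inlined as in N53).
THIS FILE (namespace `Summit.Ventures.HSemireg.Wedge.HankelOuter` continued; CHAINED on N53; 0 definitions):
* §572 `ncard_coe_degreeLT` (`#K[X]_{<d} = s^d`), `mul_monic_mem_degreeLT`, `unitResidues_one` (`= {0}`), `ncard_unitResidues_one` (`φ(1) = 1`).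
* §573 THE CHINESE REMAINDER BIJECTION **`ncard_unitResidues_mul`** (`m`, `m′` monic coprime ⇒ `φ(m m′) = φ(m) φ(m′)`; into by N45 `isCoprime_mul_add_mul`, one-to-one by `m ∣ (a − b)`,
  onto by Bezout + `modByMonic`), **`ncard_unitResidues_prod`** (finite products of pairwise coprime monic polynomials).
* §574 PRIME POWERS: `mem_unitResidues_pow_iff` (`a` is a unit mod `p^k` iff `p ∤ a`), `unitResidues_pow_eq_sdiff` (`= K[X]_{<dk} ∖ p·K[X]_{<d(k−1)}`),
  **`ncard_unitResidues_pow_of_irreducible`** (`φ(p^k) = s^{dk} − s^{d(k−1)}`, `k ≥ 1`).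
* §575 FACTORISED FORMS: **`ncard_unitResidues_prod_pow`** (`φ(∏ pᵢ^{kᵢ}) = ∏ (s^{dᵢkᵢ} − s^{dᵢ(kᵢ−1)})` for pairwise coprime monic irreducibles), **`ncard_unitResidues_prod_X_sub_C_pow`**
  (distinct nodes: `∏ (s − 1) s^{kᵢ−1}`), `ncard_unitResidues_X_sub_C_pow` (`(s − 1) s^{k−1}`), `ncard_unitResidues_prod_X_sub_C` (simple nodes: `(s − 1)^{#nodes}`).
* §576 CLASS COUNTS (N53's fibre theorem applied; `2 deg m ≤ N + 1`): **`ncard_setOf_rank_eq_and_mem_recSpace_mul`** (THE CENSUS BY MINIMAL RECURRENCE IS MULTIPLICATIVE),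
  `ncard_setOf_rank_eq_and_mem_recSpace_pow_of_irreducible`, `ncard_setOf_rank_eq_and_mem_recSpace_prod_X_sub_C_pow` (classes with prescribed distinct nodes `λᵢ` of prescribed exact
  orders `kᵢ − 1`: `∏ (s − 1) s^{kᵢ−1}` of them), `ncard_setOf_rank_eq_and_mem_recSpace_X_sub_C_pow` (one node of exact order `k − 1`: `(s − 1) s^{k−1}`).
READING (classical, docstring only, nothing used): `φ` is Euler's function of the ring `F_s[X]` (Dedekind 1857); `φ(m) = s^{deg m} ∏_{p ∣ m} (1 − s^{−deg p})`.
Nothing Ext-side.  New names only.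
-/

open Module Polynomial
open scoped Matrix Polynomial

namespace Summit.Ventures.HSemireg.Wedge.HankelOuter

open Summit.Ventures.HSemireg.Wedge Summit.Ventures.HSemireg.Wedge.Hankel

variable (K : Type*) [Field K] {N : ℕ}

/-! ## §572. Small polynomials; `φ(1) = 1` -/

/-- `#K[X]_{<d} = s^d` over a field with `s` elements (the coefficient vector; as in N53, inlined). -/
theorem ncard_coe_degreeLT [Finite K] (d : ℕ) : (Polynomial.degreeLT K d : Set K[X]).ncard = Nat.card K ^ d := by
  rw [← Nat.card_coe_set_eq, SetLike.coe_sort_coe, Nat.card_congr (Polynomial.degreeLTEquiv K d).toEquiv, Nat.card_fun, Nat.card_eq_fintype_card (α := Fin d), Fintype.card_fin]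

/-- `deg a < n`, `m′` monic ⇒ `deg (a m′) < n + deg m′`. -/
theorem mul_monic_mem_degreeLT {a m' : K[X]} {n : ℕ} (hm' : m'.Monic) (ha : a ∈ Polynomial.degreeLT K n) : a * m' ∈ Polynomial.degreeLT K (n + m'.natDegree) := by
  rcases eq_or_ne a 0 with rfl | ha0
  · rw [zero_mul]; exact Submodule.zero_mem _
  rw [Polynomial.mem_degreeLT, Polynomial.degree_eq_natDegree ha0, Nat.cast_lt] at ha
  rw [Polynomial.mem_degreeLT, Polynomial.degree_eq_natDegree (mul_ne_zero ha0 hm'.ne_zero),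
    Polynomial.natDegree_mul' (by rw [hm'.leadingCoeff, mul_one]; exact Polynomial.leadingCoeff_ne_zero.mpr ha0), Nat.cast_lt]
  omega

/-- `unitResidues 1 = {0}`: the only polynomial of degree `< 0` is `0`, and it is prime to `1`. -/
theorem unitResidues_one : unitResidues K (1 : K[X]) = {0} := by
  ext a
  rw [mem_unitResidues_iff, Polynomial.natDegree_one, Set.mem_singleton_iff, Polynomial.mem_degreeLT, Nat.cast_zero, Nat.WithBot.lt_zero_iff, Polynomial.degree_eq_bot]
  exact ⟨fun h => h.1, fun h => ⟨h, isCoprime_one_left⟩⟩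

/-- `φ(1) = 1`. -/
theorem ncard_unitResidues_one : (unitResidues K (1 : K[X])).ncard = 1 := by
  rw [unitResidues_one, Set.ncard_singleton]

/-! ## §573. The Chinese remainder bijection: `φ` is multiplicative -/

/-- **`φ(m m′) = φ(m) φ(m′)` FOR COPRIME MONIC `m`, `m′`: `(a, a′) ↦ a m′ + a′ m` is a bijection `unitResidues m × unitResidues m′ → unitResidues (m m′)`** (the symbol
`a/m + a′/m′ = (a m′ + a′ m)/(m m′)` is reduced, N45; one-to-one since `m ∣ (a − b) m′` forces `m ∣ a − b`, `deg < deg m`; onto: for `c` prime to `m m′` and `u m + v m′ = 1` take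
`a = c v mod m`, `a′ = c u mod m′` — then `m` and `m′` both divide `a m′ + a′ m − c`, which has degree `< deg (m m′)`). -/
theorem ncard_unitResidues_mul {m m' : K[X]} (hm : m.Monic) (hm' : m'.Monic) (hmm' : IsCoprime m m') :
    (unitResidues K (m * m')).ncard = (unitResidues K m).ncard * (unitResidues K m').ncard := by
  rw [← Set.ncard_prod]
  symm
  refine Set.ncard_congr (fun p _ => p.1 * m' + p.2 * m) ?_ ?_ ?_
  · rintro ⟨a, a'⟩ ⟨⟨ha, hca⟩, ⟨ha', hca'⟩⟩
    refine ⟨?_, isCoprime_mul_add_mul K hmm' hca hca'⟩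
    rw [hm.natDegree_mul hm']
    exact Submodule.add_mem _ (mul_monic_mem_degreeLT K hm' ha) (by rw [add_comm m.natDegree]; exact mul_monic_mem_degreeLT K hm ha')
  · rintro ⟨a, a'⟩ ⟨b, b'⟩ ⟨⟨ha, -⟩, -⟩ ⟨⟨hb, -⟩, -⟩ h
    dsimp only at h
    have h1 : (a - b) * m' = m * (b' - a') := by linear_combination h
    have hdvd : m ∣ a - b := hmm'.dvd_of_dvd_mul_right ⟨b' - a', h1⟩
    have hab : a = b := sub_eq_zero.mp (Polynomial.eq_zero_of_dvd_of_degree_lt hdvd (by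
      rw [Polynomial.degree_eq_natDegree hm.ne_zero]; exact Polynomial.mem_degreeLT.mp (Submodule.sub_mem _ ha hb)))
    subst hab
    have h2 : a' * m = b' * m := by linear_combination h
    rw [mul_right_cancel₀ hm.ne_zero h2]
  · rintro c ⟨hc, hcop⟩
    obtain ⟨u, v, huv⟩ := id hmm'
    have hmc : IsCoprime m c := hcop.of_mul_left_left
    have hm'c : IsCoprime m' c := hcop.of_mul_left_right
    have hmv : IsCoprime m v := ⟨u, m', by linear_combination huv⟩
    have hm'u : IsCoprime m' u := ⟨v, m, by linear_combination huv⟩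
    have e1 := Polynomial.modByMonic_add_div (c * v) m
    have e2 := Polynomial.modByMonic_add_div (c * u) m'
    refine ⟨((c * v) %ₘ m, (c * u) %ₘ m'), ⟨⟨?_, ?_⟩, ⟨?_, ?_⟩⟩, ?_⟩
    · exact Polynomial.mem_degreeLT.mpr (by rw [← Polynomial.degree_eq_natDegree hm.ne_zero]; exact Polynomial.degree_modByMonic_lt _ hm)
    · rw [show (c * v) %ₘ m = c * v + m * (-((c * v) /ₘ m)) by linear_combination e1]
      exact (hmc.mul_right hmv).add_mul_left_right _
    · exact Polynomial.mem_degreeLT.mpr (by rw [← Polynomial.degree_eq_natDegree hm'.ne_zero]; exact Polynomial.degree_modByMonic_lt _ hm')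
    · rw [show (c * u) %ₘ m' = c * u + m' * (-((c * u) /ₘ m')) by linear_combination e2]
      exact (hm'c.mul_right hm'u).add_mul_left_right _
    · dsimp only
      have hdeg : (c * v) %ₘ m * m' + (c * u) %ₘ m' * m - c ∈ Polynomial.degreeLT K (m * m').natDegree := by
        refine Submodule.sub_mem _ ?_ hc
        rw [hm.natDegree_mul hm']
        exact Submodule.add_mem _ (mul_monic_mem_degreeLT K hm' (Polynomial.mem_degreeLT.mpr (by
            rw [← Polynomial.degree_eq_natDegree hm.ne_zero]; exact Polynomial.degree_modByMonic_lt _ hm)))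
          (by rw [add_comm m.natDegree]; exact mul_monic_mem_degreeLT K hm (Polynomial.mem_degreeLT.mpr (by
            rw [← Polynomial.degree_eq_natDegree hm'.ne_zero]; exact Polynomial.degree_modByMonic_lt _ hm')))
      have hdm : m ∣ (c * v) %ₘ m * m' + (c * u) %ₘ m' * m - c :=
        ⟨-((c * v) /ₘ m) * m' + (c * u) %ₘ m' - c * u, by linear_combination m' * e1 + c * huv⟩
      have hdm' : m' ∣ (c * v) %ₘ m * m' + (c * u) %ₘ m' * m - c :=
        ⟨(c * v) %ₘ m - ((c * u) /ₘ m') * m - c * v, by linear_combination m * e2 + c * huv⟩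
      exact sub_eq_zero.mp (Polynomial.eq_zero_of_dvd_of_degree_lt (hmm'.mul_dvd hdm hdm') (by
        rw [Polynomial.degree_eq_natDegree (hm.mul hm').ne_zero]; exact Polynomial.mem_degreeLT.mp hdeg))

/-- **`φ` OF A PRODUCT OF PAIRWISE COPRIME MONIC POLYNOMIALS IS THE PRODUCT OF THE `φ`'s.** -/
theorem ncard_unitResidues_prod {ι : Type*} (s : Finset ι) (f : ι → K[X]) (hmon : ∀ i ∈ s, (f i).Monic) (hcop : (s : Set ι).Pairwise fun i j => IsCoprime (f i) (f j)) :
    (unitResidues K (∏ i ∈ s, f i)).ncard = ∏ i ∈ s, (unitResidues K (f i)).ncard := by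
  classical
  induction s using Finset.induction_on with
  | empty => rw [Finset.prod_empty, Finset.prod_empty, ncard_unitResidues_one]
  | insert i s hi ih =>
    rw [Finset.prod_insert hi, Finset.prod_insert hi]
    have hmon' : ∀ j ∈ s, (f j).Monic := fun j hj => hmon j (Finset.mem_insert_of_mem hj)
    have hcop' : (s : Set ι).Pairwise fun i j => IsCoprime (f i) (f j) := hcop.mono (by simp)
    rw [ncard_unitResidues_mul K (hmon i (Finset.mem_insert_self i s)) (Polynomial.monic_prod_of_monic s f hmon') ?_, ih hmon' hcop']
    refine IsCoprime.prod_right fun j hj => hcop (Finset.mem_insert_self i s) (Finset.mem_insert_of_mem hj) ?_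
    rintro rfl; exact hi hj

/-! ## §574. Prime powers: `φ(p^k) = s^{dk} − s^{d(k−1)}` -/

/-- `a` is a unit mod `p^k` (`k ≥ 1`, `p` irreducible) iff `p ∤ a`. -/
theorem mem_unitResidues_pow_iff {p : K[X]} (hirr : Irreducible p) {k : ℕ} (hk : 1 ≤ k) {a : K[X]} :
    a ∈ unitResidues K (p ^ k) ↔ a ∈ Polynomial.degreeLT K (p ^ k).natDegree ∧ ¬ p ∣ a := by
  rw [mem_unitResidues_iff, IsCoprime.pow_left_iff (by omega), hirr.coprime_iff_not_dvd]

/-- **`unitResidues (p^k) = K[X]_{<dk} ∖ p · K[X]_{<d(k−1)}`** (`p` monic irreducible of degree `d`, `k ≥ 1`): the non-units below `p^k` are the multiples `p b`, `deg b < d(k−1)`. -/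
theorem unitResidues_pow_eq_sdiff {p : K[X]} (hp : p.Monic) (hirr : Irreducible p) {k : ℕ} (hk : 1 ≤ k) :
    unitResidues K (p ^ k) = (Polynomial.degreeLT K (p.natDegree * k) : Set K[X]) \ ((fun b => p * b) '' (Polynomial.degreeLT K (p.natDegree * (k - 1)) : Set K[X])) := by
  ext a
  rw [mem_unitResidues_pow_iff K hirr hk, hp.natDegree_pow, mul_comm k, Set.mem_sdiff, SetLike.mem_coe]
  refine and_congr_right fun ha => not_congr ⟨fun ⟨b, hb⟩ => ⟨b, ?_, hb.symm⟩, fun ⟨b, _, hb⟩ => ⟨b, hb.symm⟩⟩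
  rw [SetLike.mem_coe]
  subst hb
  rcases eq_or_ne b 0 with rfl | hb0
  · exact Submodule.zero_mem _
  rw [Polynomial.mem_degreeLT, Polynomial.degree_eq_natDegree (mul_ne_zero hp.ne_zero hb0), hp.natDegree_mul' hb0, Nat.cast_lt] at ha
  rw [Polynomial.mem_degreeLT, Polynomial.degree_eq_natDegree hb0, Nat.cast_lt]
  have : p.natDegree * k = p.natDegree * (k - 1) + p.natDegree := by
    obtain ⟨j, rfl⟩ : ∃ j, k = j + 1 := ⟨k - 1, by omega⟩
    rw [Nat.add_sub_cancel, Nat.mul_succ]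
  omega

/-- **`φ(p^k) = s^{dk} − s^{d(k−1)}` for `p` monic irreducible of degree `d` and `k ≥ 1`** (`k = 1`: N53's `s^d − 1`). -/
theorem ncard_unitResidues_pow_of_irreducible [Finite K] {p : K[X]} (hp : p.Monic) (hirr : Irreducible p) {k : ℕ} (hk : 1 ≤ k) :
    (unitResidues K (p ^ k)).ncard = Nat.card K ^ (p.natDegree * k) - Nat.card K ^ (p.natDegree * (k - 1)) := by
  have hsub : (fun b => p * b) '' (Polynomial.degreeLT K (p.natDegree * (k - 1)) : Set K[X]) ⊆ (Polynomial.degreeLT K (p.natDegree * k) : Set K[X]) := by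
    rintro _ ⟨b, hb, rfl⟩
    rw [SetLike.mem_coe] at hb ⊢
    have := mul_monic_mem_degreeLT K hp hb
    rw [mul_comm b p, show p.natDegree * (k - 1) + p.natDegree = p.natDegree * k by
      obtain ⟨j, rfl⟩ : ∃ j, k = j + 1 := ⟨k - 1, by omega⟩
      rw [Nat.add_sub_cancel, Nat.mul_succ]] at this
    exact this
  have hfin : ((fun b => p * b) '' (Polynomial.degreeLT K (p.natDegree * (k - 1)) : Set K[X])).Finite :=
    (Set.finite_coe_iff.mp (Finite.of_equiv _ (Polynomial.degreeLTEquiv K (p.natDegree * (k - 1))).toEquiv.symm)).image _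
  rw [unitResidues_pow_eq_sdiff K hp hirr hk, Set.ncard_sdiff hsub hfin, ((mul_right_injective₀ hp.ne_zero).injOn).ncard_image, ncard_coe_degreeLT, ncard_coe_degreeLT]

/-! ## §575. Factorised forms -/

/-- **EULER'S FUNCTION OF `K[X]`, FACTORISED FORM: `φ(∏ pᵢ^{kᵢ}) = ∏ (s^{dᵢkᵢ} − s^{dᵢ(kᵢ−1)})`** for pairwise coprime monic irreducibles `pᵢ` of degrees `dᵢ` and exponents `kᵢ ≥ 1`. -/
theorem ncard_unitResidues_prod_pow [Finite K] {ι : Type*} (s : Finset ι) (p : ι → K[X]) (k : ι → ℕ) (hmon : ∀ i ∈ s, (p i).Monic) (hirr : ∀ i ∈ s, Irreducible (p i))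
    (hcop : (s : Set ι).Pairwise fun i j => IsCoprime (p i) (p j)) (hk : ∀ i ∈ s, 1 ≤ k i) :
    (unitResidues K (∏ i ∈ s, p i ^ k i)).ncard = ∏ i ∈ s, (Nat.card K ^ ((p i).natDegree * k i) - Nat.card K ^ ((p i).natDegree * (k i - 1))) := by
  rw [ncard_unitResidues_prod K s (fun i => p i ^ k i) (fun i hi => (hmon i hi).pow _) (fun i hi j hj hij => (hcop hi hj hij).pow)]
  exact Finset.prod_congr rfl fun i hi => ncard_unitResidues_pow_of_irreducible K (hmon i hi) (hirr i hi) (hk i hi)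

/-- arithmetic: `s^k − s^{k−1} = (s − 1) s^{k−1}` (`k ≥ 1`). -/
theorem pow_sub_pow_pred (s : ℕ) {k : ℕ} (hk : 1 ≤ k) : s ^ k - s ^ (k - 1) = (s - 1) * s ^ (k - 1) := by
  obtain ⟨j, rfl⟩ : ∃ j, k = j + 1 := ⟨k - 1, by omega⟩
  rw [Nat.add_sub_cancel, pow_succ, tsub_mul, one_mul, mul_comm]

/-- **DISTINCT NODES WITH MULTIPLICITIES: `φ(∏ (X − λᵢ)^{kᵢ}) = ∏ (s − 1) s^{kᵢ−1}`** (`λ` injective on the index set, `kᵢ ≥ 1`). -/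
theorem ncard_unitResidues_prod_X_sub_C_pow [Finite K] {ι : Type*} (s : Finset ι) (c : ι → K) (hc : Set.InjOn c s) (k : ι → ℕ) (hk : ∀ i ∈ s, 1 ≤ k i) :
    (unitResidues K (∏ i ∈ s, (Polynomial.X - Polynomial.C (c i)) ^ k i)).ncard = ∏ i ∈ s, (Nat.card K - 1) * Nat.card K ^ (k i - 1) := by
  rw [ncard_unitResidues_prod_pow K s (fun i => Polynomial.X - Polynomial.C (c i)) k (fun i _ => Polynomial.monic_X_sub_C (c i))
    (fun i _ => Polynomial.irreducible_X_sub_C (c i)) (fun i hi j hj hij => Polynomial.isCoprime_X_sub_C_of_isUnit_sub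
      (IsUnit.mk0 _ (sub_ne_zero.mpr fun h => hij (hc hi hj h)))) hk]
  refine Finset.prod_congr rfl fun i hi => ?_
  rw [Polynomial.natDegree_X_sub_C, one_mul, one_mul, pow_sub_pow_pred _ (hk i hi)]

/-- **ONE NODE OF MULTIPLICITY `k`: `φ((X − λ)^k) = (s − 1) s^{k−1}`** (`k ≥ 1`). -/
theorem ncard_unitResidues_X_sub_C_pow [Finite K] (c : K) {k : ℕ} (hk : 1 ≤ k) :
    (unitResidues K ((Polynomial.X - Polynomial.C c) ^ k)).ncard = (Nat.card K - 1) * Nat.card K ^ (k - 1) := by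
  have h := ncard_unitResidues_prod_X_sub_C_pow K ({()} : Finset Unit) (fun _ => c) (Set.injOn_of_injective fun _ _ _ => rfl) (fun _ => k) (fun _ _ => hk)
  rwa [Finset.prod_singleton, Finset.prod_singleton] at h

/-- **SIMPLE DISTINCT NODES: `φ(∏ (X − λᵢ)) = (s − 1)^{#nodes}`** (`λ` injective on the index set). -/
theorem ncard_unitResidues_prod_X_sub_C [Finite K] {ι : Type*} (s : Finset ι) (c : ι → K) (hc : Set.InjOn c s) :
    (unitResidues K (∏ i ∈ s, (Polynomial.X - Polynomial.C (c i)))).ncard = (Nat.card K - 1) ^ s.card := by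
  have h := ncard_unitResidues_prod_X_sub_C_pow K s c hc (fun _ => 1) (fun _ _ => le_rfl)
  simp only [pow_one, Nat.sub_self, pow_zero, mul_one, Finset.prod_const] at h
  exact h

/-! ## §576. Class counts: the census by minimal recurrence, for every `m` -/

/-- **THE CENSUS BY MINIMAL RECURRENCE IS MULTIPLICATIVE: for coprime monic `m`, `m′` with `2 deg(m m′) ≤ N + 1`, the number of classes `v` on `[0, N]` with minimal recurrence `m m′`
(`R^N(v) = deg(m m′)`, `m m′ ∈ Rec^N(v)`) is the product of the numbers of classes with minimal recurrence `m` and with minimal recurrence `m′`** (N53's fibre theorem three times + §573). -/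
theorem ncard_setOf_rank_eq_and_mem_recSpace_mul {m m' : K[X]} (hm : m.Monic) (hm' : m'.Monic) (hmm' : IsCoprime m m') (h2 : (m * m').natDegree + (m * m').natDegree ≤ N + 1) :
    {v : Fin (N + 1) → K | (hankel1 K N (N / 2) (seqOf K v)).rank = (m * m').natDegree ∧ m * m' ∈ recSpace K N (seqOf K v) (m * m').natDegree}.ncard =
      {v : Fin (N + 1) → K | (hankel1 K N (N / 2) (seqOf K v)).rank = m.natDegree ∧ m ∈ recSpace K N (seqOf K v) m.natDegree}.ncard *
      {v : Fin (N + 1) → K | (hankel1 K N (N / 2) (seqOf K v)).rank = m'.natDegree ∧ m' ∈ recSpace K N (seqOf K v) m'.natDegree}.ncard := by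
  have hd := hm.natDegree_mul hm'
  rw [ncard_setOf_rank_eq_and_mem_recSpace K (hm.mul hm') h2, ncard_setOf_rank_eq_and_mem_recSpace K hm (by omega), ncard_setOf_rank_eq_and_mem_recSpace K hm' (by omega),
    ncard_unitResidues_mul K hm hm' hmm']

/-- **`s^{dk} − s^{d(k−1)}` CLASSES WITH MINIMAL RECURRENCE `p^k`** (`p` monic irreducible of degree `d`, `k ≥ 1`, `2dk ≤ N + 1`). -/
theorem ncard_setOf_rank_eq_and_mem_recSpace_pow_of_irreducible [Finite K] {p : K[X]} (hp : p.Monic) (hirr : Irreducible p) {k : ℕ} (hk : 1 ≤ k)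
    (h2 : (p ^ k).natDegree + (p ^ k).natDegree ≤ N + 1) :
    {v : Fin (N + 1) → K | (hankel1 K N (N / 2) (seqOf K v)).rank = (p ^ k).natDegree ∧ p ^ k ∈ recSpace K N (seqOf K v) (p ^ k).natDegree}.ncard =
      Nat.card K ^ (p.natDegree * k) - Nat.card K ^ (p.natDegree * (k - 1)) := by
  rw [ncard_setOf_rank_eq_and_mem_recSpace K (hp.pow k) h2, ncard_unitResidues_pow_of_irreducible K hp hirr hk]

/-- **CLASSES WITH PRESCRIBED DISTINCT NODES AND PRESCRIBED EXACT ORDERS: with `m = ∏ᵢ (X − λᵢ)^{kᵢ}` (`λ` injective on the index set, `kᵢ ≥ 1`, `2 deg m ≤ N + 1`) exactly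
`∏ᵢ (s − 1) s^{kᵢ−1}` classes `v` on `[0, N]` have minimal recurrence `m`** (dictionary, N20/N35: the classes `Σᵢ expMul λᵢ qᵢ` with `qᵢ` of exact order `kᵢ − 1`). -/
theorem ncard_setOf_rank_eq_and_mem_recSpace_prod_X_sub_C_pow [Finite K] {ι : Type*} (s : Finset ι) (c : ι → K) (hc : Set.InjOn c s) (k : ι → ℕ) (hk : ∀ i ∈ s, 1 ≤ k i)
    (h2 : (∏ i ∈ s, (Polynomial.X - Polynomial.C (c i)) ^ k i).natDegree + (∏ i ∈ s, (Polynomial.X - Polynomial.C (c i)) ^ k i).natDegree ≤ N + 1) :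
    {v : Fin (N + 1) → K | (hankel1 K N (N / 2) (seqOf K v)).rank = (∏ i ∈ s, (Polynomial.X - Polynomial.C (c i)) ^ k i).natDegree ∧
        (∏ i ∈ s, (Polynomial.X - Polynomial.C (c i)) ^ k i) ∈ recSpace K N (seqOf K v) (∏ i ∈ s, (Polynomial.X - Polynomial.C (c i)) ^ k i).natDegree}.ncard =
      ∏ i ∈ s, (Nat.card K - 1) * Nat.card K ^ (k i - 1) := by
  rw [ncard_setOf_rank_eq_and_mem_recSpace K (Polynomial.monic_prod_of_monic _ _ fun i _ => (Polynomial.monic_X_sub_C (c i)).pow _) h2,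
    ncard_unitResidues_prod_X_sub_C_pow K s c hc k hk]

/-- **ONE NODE `λ` OF EXACT ORDER `k − 1`: `(s − 1) s^{k−1}` classes on `[0, N]` have minimal recurrence `(X − λ)^k`** (`k ≥ 1`, `2k ≤ N + 1`). -/
theorem ncard_setOf_rank_eq_and_mem_recSpace_X_sub_C_pow [Finite K] (c : K) {k : ℕ} (hk : 1 ≤ k) (h2 : k + k ≤ N + 1) :
    {v : Fin (N + 1) → K | (hankel1 K N (N / 2) (seqOf K v)).rank = k ∧ (Polynomial.X - Polynomial.C c) ^ k ∈ recSpace K N (seqOf K v) k}.ncard =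
      (Nat.card K - 1) * Nat.card K ^ (k - 1) := by
  have hd : ((Polynomial.X - Polynomial.C c) ^ k).natDegree = k := by rw [(Polynomial.monic_X_sub_C c).natDegree_pow, Polynomial.natDegree_X_sub_C, mul_one]
  have h := ncard_setOf_rank_eq_and_mem_recSpace K (N := N) ((Polynomial.monic_X_sub_C c).pow k) (by rw [hd]; exact h2)
  rw [hd] at h
  rw [h, ncard_unitResidues_X_sub_C_pow K c hk]

end Summit.Ventures.HSemireg.Wedge.HankelOuter
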